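import Summits.QuantumFields.BalabanUV.Beta.FP.TorusCompositeObjects
import Summits.QuantumFields.BalabanUV.Beta.CompositeCorrectorCovariance

/-!
# `BalabanUV.Beta.FP.TorusCompositeRowsPeriodic` — road «FP» for binder row D1, ROUTE T: **`compRows` IS THE PERIODISED COMPOSITE ROOTED LINEAR AVERAGING —
# the tower's `n+1`-fold averaging rows (leaf-06 `TorusCompositeObjects.compRows`, our torus bookkeeping) ACT ON PERIODIC 1-FORMS AS `(∏ stepScale) ·` an2∕an3's
# LATTICE composite `CompositeAveragingCoarseExact.compLinAvgAt`** (the chart-side half of the (C1)-0 junction located by the row-D1 OWNER an2 g48, W-3 (c),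
# HOME/CLAIMS.log l.53579: «the junction `perF` of `compLinAvgAt r L m` rows = `compRows` is the one new lemma (C1)-0 owes on the chart side»)

WHY.  The (S3-1) one-shot legs of the OWNER's #41d `TowerLawFullIndex` (systems N and F over the finest torus `T = towerTorus Lc M (n+1)`) are discharged by
leaf-05's `PackedLegBlocksAtSlices.kkt_mul_inv_oneShot ∕ packedLeg_oneShot_eq` at a LATTICE chart `(A, 𝕄)` whose periodised border `Q♯ := (perF T 𝕄).submatrix fμ (ff)`
must be IDENTIFIED with the door's averaging rows `Q₁₀ := compRows Lc M lev rs (n+1)` (#21 `hQ₁₀`).  The row's composite chart of record (K-U3d, `bhKcomp r L m =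
Φ̂ᵀ∘bhK(L^m)∘Φ̂`) has border `[proj (L^m) x = 0]·compLinAvgAt r L m δ_{(β,w)} κ (x∕L^m)` (`CompositeCorrectorBordered.trK_phiK_bhK_phiK_inr_inl`).  THIS FILE proves
the torus∕lattice dictionary between the two composite averagings, chart-free:

* §1 ONE STEP.  `sum_perZ_bhKAt_mul_periodic`: the multiplier rows of the periodised ROOTED bordered Hessian act on an `M`-periodic form `B` as an1's rooted
  average: `Σ_{y ∈ pbox M} Σ_l perZ M (bhKAt ρ N) p y (inr κ)(inl l)·B l y = linAvgAt ρ B N κ (p∕N)` (bond-count representation `TorusGaugeCovariance.tsum_linCountAt_mul`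
  unfolded along box × period lattice — the pattern of `perF_bhKAt_mul_tgrad` with the periodic gradient replaced by any periodic form); `sum_Qstep_mul_periodic`:
  `Σ_q Qstep Lc M ℓ r (x,κ) q·B q.2 q.1 = stepScale d Lc ℓ·linAvgAt (toSite r) B Lc κ x` (`perF_bhKStepAt_inr`, `coarsePt = Lc • ·`).
* §2 THE COMPOSITE.  `compLinAvgAt_periodic` (a form periodic under the finest torus of a tower has a composite average periodic under the top torus one storey
  below — `compLinAvgAt_shift` + `towerTorus_apply`) and **`sum_compRows_mul_periodic`**: for every `T`-periodic real 1-form `A`,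
  `Σ_{q ∈ pbox T × Fin (d+1)} compRows Lc M lev rs (n+1) (x,κ) q · A q.2 q.1 = (∏_{i<n+1} stepScale d Lc (lev (i+1))) · compLinAvgAt r Lc (n+1) A κ x`
  — induction on the depth: TOP-PEEL on both sides (`compRows_succ` ∕ `compLinAvgAt_succ`), §1 at the top applied to the periodic composite average of the tower
  below.  ROOT DICTIONARY (index bookkeeping only): the tower's roots `rs` are indexed FROM THE TOP (`rs 1` = the step `M ← fine Lc M`, `rs (n+1)` the finest),
  an2's `r` FROM THE BOTTOM (`r 0` the finest step): `hr : ∀ i j, i + j = n → r i = rs (j+1)`.  SCALE: every level-`ℓ` step carries `stepScale d Lc ℓ`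
  (`bhKStepAt_inr`; `= 1` at `ℓ = 0`), so the tower carries #21's `∏_{i<n+1} stepScale d Lc (lev (i+1))`.  `sum_topStep_mul_compRows_mul_periodic`: the same
  with ONE MORE STEP ON TOP read through a slot presentation `a ↦ (pμ a, inr (mμ a))`, `proj Lc (pμ a) = 0` (the door's `𝔔₀ = Q₂₀ * Q₁₀`, system N):
  scale `∏_{i<n+2} stepScale d Lc (lev i)`, composite `compLinAvgAt r Lc (n+2)` read at `(mμ a, pμ a ∕ Lc)`, dictionary `r i = rs j` for `i + j = n + 1`.
* §3 `compRows_apply_eq_compLinAvgAt_wrap`: the ENTRY `compRows … (x,κ) (z,β)` is `(∏ stepScale) ·` the composite average at `(κ, x)` of the `T`-PERIODIC INDICATOR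
  `(l,w) ↦ δ_{(β,z)}(l, wrap T w)` of the bond `(β, z)` (§2 at that form).
The period-sum (`perZ`) form of the entries and the `perF` packaging `(perF T K).submatrix fμ (ff) = compRows …` for any lattice kernel with that border are the sequel
`FP/TorusCompositeRowsLattice` (they need the lattice-side locality `CompositeCorrectorLocality.depOn_compLinAvgAt`).

[folklore] finite sums + absolutely convergent re-indexing BY NAME over OUR bookkeeping objects (`Qstep ∕ compRows ∕ towerTorus`, leaf-06 g20) and the row's typed lattice
objects (`linAvgAt`, `compLinAvgAt`, `bhKAt ∕ bhKStepAt`, `perZ ∕ perF`); no `def`, no `def … : Prop`, nothing cited, 0 sorry.  Nothing of the dictionary ∕ Bałaban's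
non-linear averages asserted beyond their typed linearisations; NO chart is fixed here (the (C1) chart of record and its scale are the row's — an2 W-3 (a)(b)).
NOT HERE: the `hH` block identification (`bhK|ff` vs `bhKStep|ff`, the row's located lemma), the legs, (P2‴), the END.

HONEST DEPENDENCY (page 1, mandatory): continuum YM on T⁴ ⇐ BetaPertH ∧ nine spine estimates (0/9 proved); BetaPertH ⇐ (D1) ∧ (D4) ∧ CAP+tail;
G-an2-4 gates asym, D1 and NE2/3/4.  HONEST FRAMING (cell contract, verbatim): «discharging `BetaPertH` makes Bałaban's UV stability UNCONDITIONAL —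
a real constructive-QFT result; it is NOT the continuum limit and NOT the Clay problem.»  ABSOLUTE RULE (cell charter, verbatim): «No internally-minted
statement may enter as a cited fact. Every hypothesis is either kernel-proved in this package or a verbatim quotation of a PUBLISHED theorem with page
reference. The manuscript(s) under audit are NOT citable for their own disputed steps — they are the thing under adjudication; programme-internal
(2001/route/tribunal) claims are never citable.»  0 estimates; 0∕4 row-D1 binders (hW, hR, D1Tel, D1Rep); NOT (T-ID), NOT (C1), NOT SDF, NOT D1,
NOT BetaPertH, NOT continuum, NOT Clay.  D1 formalisation swarm LEAF PROVER 02 (b2b-balaban-beta-d1-formalise-leaf-02 gen 27), 2026-08-23.  No existing file touched.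
-/

noncomputable section

open scoped BigOperators Matrix

namespace Summit.QuantumFields.BalabanUV.Beta.FP.TorusCompositeRowsPeriodic

open Matrix Finset
open Literature.Probability.LatticeModels (Torus.proj)
open Literature.MathematicalPhysics.QuantumFieldTheory
open Literature.MathematicalPhysics.QuantumFieldTheory.Balaban1983to89
open Literature.MathematicalPhysics.QuantumFieldTheory.Balaban1983to89.Beta
open B5Prop11Plancherel (fine)
open B6Lemma24Torus (pbox mem_pbox wrap wrap_eq_self)
open B4TorusKernel.MultiPeriod (translate translate_apply)
open AffineAveraging (Site Form1 box toSite)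
open AveragingContours (shift)
open AveragingContoursRooted (linAvgAt)
open AveragingHessianKernelsRooted (linCountAt)
open KKTFluctuationKernel (delta1 delta1_apply)
open LatticeForm (quo)
open OneStepResolventKernel (Fib proj_zsmul quo_zsmul)
open Summit.QuantumFields.BalabanUV.Beta.BorderedHessian (bhKAt bhKStepAt stepScale)
open Summit.QuantumFields.BalabanUV.Beta.FP.KernelPeriodisationFib (Idx perF perF_apply perZ perZ_apply translate_eq_add)
open Summit.QuantumFields.BalabanUV.Beta.FP.KernelPeriodisationFibTrace (tsum_sites_eq_sum_tsum)
open Summit.QuantumFields.BalabanUV.Beta.FP.TorusGaugeCovariance (perF_bhKStepAt_inr bhKAt_inr_inl_of_proj tsum_linCountAt_mul nearBox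
  linCountAt_eq_zero_of_not_mem)
open Summit.QuantumFields.BalabanUV.Beta.FP.TorusGaugeCovarianceCoarse (coarsePt coarsePt_coe)
open Summit.QuantumFields.BalabanUV.Beta.FP.TorusCompositeObjects (towerTorus towerTorus_apply Qstep compRows compRows_succ compRows_one)
open Summit.QuantumFields.BalabanUV.Beta.CompositeAveragingCoarseExact (compLinAvgAt compLinAvgAt_succ compLinAvgAt_one)
open Summit.QuantumFields.BalabanUV.Beta.CompositeCorrectorCovariance (compLinAvgAt_shift)


variable {d : ℕ}

/-! ## §1 One step: the periodised rooted averaging rows ACT ON PERIODIC FORMS AS the rooted linear averaging -/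

section OneStep

variable (M : Fin (d + 1) → ℕ) [∀ μ, NeZero (M μ)] {N : ℕ} [NeZero N] {r : Fin (d + 1) → ℕ}

omit [NeZero N] in
/-- [folklore] **THE PERIODISED ROOTED AVERAGING ROWS ACT ON `M`-PERIODIC 1-FORMS AS THE LATTICE ROOTED AVERAGING**: for an in-block root
`ρ = toSite r`, a coarse point `p` of the box `M` (`proj N p = 0`) and an `M`-periodic real 1-form `B` on `ℤ^{d+1}`,
`Σ_{y ∈ pbox M} Σ_l perZ M (bhKAt d ρ N) p y (inr κ) (inl l) · B l y = linAvgAt ρ B N κ (p∕N)`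
(an1's bond-count representation `tsum_linCountAt_mul`, unfolded along the box and the period lattice). -/
theorem sum_perZ_bhKAt_mul_periodic (hr : r ∈ box (d + 1) N) (B : Form1 (d + 1) ℝ)
    (hB : ∀ (l : Fin (d + 1)) (y m : Fin (d + 1) → ℤ), B l (translate M y m) = B l y)
    {p : Fin (d + 1) → ℤ} (hp : Torus.proj N p = 0) (κ : Fin (d + 1)) :
    ∑ y : ↥(pbox M), ∑ l : Fin (d + 1), perZ M (bhKAt d (toSite r) N) p (y : Fin (d + 1) → ℤ) (Sum.inr κ) (Sum.inl l) * B l (y : Fin (d + 1) → ℤ)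
      = linAvgAt (toSite r) B N κ (quo N p) := by
  -- the summand family on `ℤ^{d+1}` (bond counts × the periodic form) and its finite support
  set H : Fin (d + 1) → (Fin (d + 1) → ℤ) → ℝ := fun l z => (linCountAt (toSite r) N κ (quo N p) (l, z) : ℝ) * B l z with hH
  have hHfin : ∀ l, ∀ z ∉ nearBox N (quo N p), H l z = 0 := fun l z hz => by
    simp only [hH]
    rw [linCountAt_eq_zero_of_not_mem hr κ hz l, Int.cast_zero, zero_mul]
  have hHs : ∀ l, Summable (H l) := fun l => summable_of_ne_finset_zero (hHfin l)
  have hterm : ∀ (y : ↥(pbox M)) (l : Fin (d + 1)),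
      perZ M (bhKAt d (toSite r) N) p (y : Fin (d + 1) → ℤ) (Sum.inr κ) (Sum.inl l) * B l (y : Fin (d + 1) → ℤ)
        = ∑' m : Fin (d + 1) → ℤ, H l (translate M (y : Fin (d + 1) → ℤ) m) := fun y l => by
    rw [perZ_apply, ← tsum_mul_right]
    refine tsum_congr fun m => ?_
    simp only [hH]
    rw [bhKAt_inr_inl_of_proj (r := r) hp, hB]
  calc ∑ y : ↥(pbox M), ∑ l : Fin (d + 1),
        perZ M (bhKAt d (toSite r) N) p (y : Fin (d + 1) → ℤ) (Sum.inr κ) (Sum.inl l) * B l (y : Fin (d + 1) → ℤ)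
      = ∑ y : ↥(pbox M), ∑ l : Fin (d + 1), ∑' m : Fin (d + 1) → ℤ, H l (translate M (y : Fin (d + 1) → ℤ) m) := by
        refine Finset.sum_congr rfl fun y _ => Finset.sum_congr rfl fun l _ => hterm y l
    _ = ∑ l : Fin (d + 1), ∑ y : ↥(pbox M), ∑' m : Fin (d + 1) → ℤ, H l (translate M (y : Fin (d + 1) → ℤ) m) := Finset.sum_comm
    _ = ∑ l : Fin (d + 1), ∑' z : Fin (d + 1) → ℤ, H l z := by
        refine Finset.sum_congr rfl fun l _ => (tsum_sites_eq_sum_tsum M (hHs l)).symm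
    _ = ∑' z : Fin (d + 1) → ℤ, ∑ l : Fin (d + 1), H l z := (Summable.tsum_finsetSum fun l _ => hHs l).symm
    _ = linAvgAt (toSite r) B N κ (quo N p) := by
        simp only [hH]; exact tsum_linCountAt_mul hr B κ (quo N p)

end OneStep

section Step

variable (Lc : ℕ) [NeZero Lc] (M : Fin (d + 1) → ℕ) [∀ μ, NeZero (M μ)]

/-- [folklore] **THE ONE-STEP AVERAGING ROWS `Qstep` ACT ON `fine Lc M`-PERIODIC 1-FORMS AS `stepScale ℓ ·` THE ROOTED LINEAR AVERAGING**:
`Σ_q Qstep Lc M ℓ r (x, κ) q · B q.2 q.1 = stepScale d Lc ℓ · linAvgAt (toSite r) B Lc κ x`. -/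
theorem sum_Qstep_mul_periodic (ℓ : ℕ) {r : Fin (d + 1) → ℕ} (hr : r ∈ box (d + 1) Lc) (B : Form1 (d + 1) ℝ)
    (hB : ∀ (l : Fin (d + 1)) (y m : Fin (d + 1) → ℤ), B l (translate (fine Lc M) y m) = B l y)
    (x : ↥(pbox M)) (κ : Fin (d + 1)) :
    ∑ q : ↥(pbox (fine Lc M)) × Fin (d + 1), Qstep Lc M ℓ r (x, κ) q * B q.2 (q.1 : Fin (d + 1) → ℤ)
      = stepScale d Lc ℓ * linAvgAt (toSite r) B Lc κ (x : Fin (d + 1) → ℤ) := by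
  have hp : Torus.proj Lc ((coarsePt M Lc x : ↥(pbox (fine Lc M))) : Fin (d + 1) → ℤ) = 0 := by
    rw [coarsePt_coe]; exact proj_zsmul (N := Lc) _
  have hq : quo Lc ((coarsePt M Lc x : ↥(pbox (fine Lc M))) : Fin (d + 1) → ℤ) = (x : Fin (d + 1) → ℤ) := by
    rw [coarsePt_coe]; exact quo_zsmul (N := Lc) _
  have hentry : ∀ q : ↥(pbox (fine Lc M)) × Fin (d + 1), Qstep Lc M ℓ r (x, κ) q
      = stepScale d Lc ℓ * perZ (fine Lc M) (bhKAt d (toSite r) Lc) ((coarsePt M Lc x : ↥(pbox (fine Lc M))) : Fin (d + 1) → ℤ)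
          (q.1 : Fin (d + 1) → ℤ) (Sum.inr κ) (Sum.inl q.2) := fun q => by
    show perF (fine Lc M) (bhKStepAt d (toSite r) Lc ℓ) (coarsePt M Lc x, Sum.inr κ) (q.1, Sum.inl q.2) = _
    rw [perF_bhKStepAt_inr, perF_apply]
  calc ∑ q : ↥(pbox (fine Lc M)) × Fin (d + 1), Qstep Lc M ℓ r (x, κ) q * B q.2 (q.1 : Fin (d + 1) → ℤ)
      = stepScale d Lc ℓ * ∑ y : ↥(pbox (fine Lc M)), ∑ l : Fin (d + 1),
          perZ (fine Lc M) (bhKAt d (toSite r) Lc) ((coarsePt M Lc x : ↥(pbox (fine Lc M))) : Fin (d + 1) → ℤ) (y : Fin (d + 1) → ℤ)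
            (Sum.inr κ) (Sum.inl l) * B l (y : Fin (d + 1) → ℤ) := by
        rw [Finset.mul_sum, Fintype.sum_prod_type]
        refine Finset.sum_congr rfl fun y _ => ?_
        rw [Finset.mul_sum]
        refine Finset.sum_congr rfl fun l _ => ?_
        rw [hentry, mul_assoc]
    _ = stepScale d Lc ℓ * linAvgAt (toSite r) B Lc κ (x : Fin (d + 1) → ℤ) := by
        rw [sum_perZ_bhKAt_mul_periodic (fine Lc M) hr B hB hp κ, hq]

end Step

/-! ## §2 The composite: `compRows … (n+1)` ACTS ON PERIODIC FORMS AS `(∏ stepScale) · compLinAvgAt r Lc (n+1)` -/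

section Composite

variable (Lc : ℕ) [NeZero Lc]

omit [NeZero Lc] in
/-- [folklore] periodicity one level up: the composite average of a form periodic under the finest torus of the tower is periodic under the top
torus one storey below (`compLinAvgAt_shift` + `towerTorus_apply`). -/
theorem compLinAvgAt_periodic (M : Fin (d + 1) → ℕ) (n : ℕ) (r : ℕ → (Fin (d + 1) → ℕ)) (A : Form1 (d + 1) ℝ)
    (hA : ∀ (l : Fin (d + 1)) (w t : Fin (d + 1) → ℤ), A l (translate (towerTorus Lc M n) w t) = A l w)
    (l : Fin (d + 1)) (y u : Fin (d + 1) → ℤ) :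
    compLinAvgAt r Lc n A l (translate M y u) = compLinAvgAt r Lc n A l y := by
  have hshift : shift ((((Lc ^ (0 + n) : ℕ) : ℤ)) • (fun i => (M i : ℤ) * u i)) A = A := by
    funext l' w
    show A l' (w + _) = A l' w
    have hw : w + (((Lc ^ (0 + n) : ℕ) : ℤ)) • (fun i => (M i : ℤ) * u i) = translate (towerTorus Lc M n) w u := by
      funext i
      simp only [Pi.add_apply, Pi.smul_apply, smul_eq_mul, translate_apply, towerTorus_apply, zero_add, Nat.cast_mul, Nat.cast_pow]
      ring
    rw [hw, hA]
  have h := compLinAvgAt_shift r Lc A (fun i => (M i : ℤ) * u i) n 0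
  rw [hshift, pow_zero, Nat.cast_one, one_smul] at h
  have hv : translate M y u = y + (fun i => (M i : ℤ) * u i) := by
    funext i; simp only [translate_apply, Pi.add_apply]
  rw [hv]
  show shift (fun i => (M i : ℤ) * u i) (compLinAvgAt r Lc n A) l y = _
  rw [← h]

/-- [folklore] **`compRows` IS THE PERIODISED COMPOSITE ROOTED LINEAR AVERAGING — ACTION ON PERIODIC FORMS.**  For the tower of depth `n+1` below
`M` (finest torus `T = towerTorus Lc M (n+1)`, levels `lev`, in-block roots `rs` indexed FROM THE TOP) and an2∕an3's lattice composite
`compLinAvgAt r Lc (n+1)` (roots `r` indexed FROM THE BOTTOM: `r i = rs (j+1)` whenever `i + j = n`), and every `T`-periodic real 1-form `A` on `ℤ^{d+1}`: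
`Σ_{q ∈ pbox T × Fin (d+1)} compRows Lc M lev rs (n+1) (x, κ) q · A q.2 q.1 = (∏_{i<n+1} stepScale d Lc (lev (i+1))) · compLinAvgAt r Lc (n+1) A κ x`.
Induction on the depth: TOP-PEEL `compRows_succ` on the torus side, `compLinAvgAt_succ` on the lattice side, the one-step action `sum_Qstep_mul_periodic`
at the top applied to the (periodic, `compLinAvgAt_periodic`) composite average of the tower below. -/
theorem sum_compRows_mul_periodic :
    ∀ (n : ℕ) (M : Fin (d + 1) → ℕ) [∀ μ, NeZero (M μ)] (lev : ℕ → ℕ) (rs : ℕ → (Fin (d + 1) → ℕ)) (_ : ∀ k, rs k ∈ box (d + 1) Lc)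
      (r : ℕ → (Fin (d + 1) → ℕ)) (_ : ∀ i j : ℕ, i + j = n → r i = rs (j + 1)) (A : Form1 (d + 1) ℝ)
      (_ : ∀ (l : Fin (d + 1)) (w t : Fin (d + 1) → ℤ), A l (translate (towerTorus Lc M (n + 1)) w t) = A l w) (x : ↥(pbox M)) (κ : Fin (d + 1)),
      ∑ q : ↥(pbox (towerTorus Lc M (n + 1))) × Fin (d + 1), compRows Lc M lev rs (n + 1) (x, κ) q * A q.2 (q.1 : Fin (d + 1) → ℤ)
        = (∏ i ∈ Finset.range (n + 1), stepScale d Lc (lev (i + 1))) * compLinAvgAt r Lc (n + 1) A κ (x : Fin (d + 1) → ℤ)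
  | 0, M, _, lev, rs, hrs, r, hr, A, hA, x, κ => by
      have h0 : r 0 = rs 1 := hr 0 0 rfl
      rw [Finset.prod_range_one, compLinAvgAt_one, h0, compRows_one]
      exact sum_Qstep_mul_periodic Lc M (lev 1) (hrs 1) A hA x κ
  | n + 1, M, _, lev, rs, hrs, r, hr, A, hA, x, κ => by
      -- the tower below `M`: top `fine Lc M`, depth `n+1`, same finest torus (push-inside, `rfl`), same bottom-indexed roots `r`
      have hr' : ∀ i j : ℕ, i + j = n → r i = rs (j + 1 + 1) := fun i j hij => hr i (j + 1) (by omega)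
      have IH := sum_compRows_mul_periodic n (fine Lc M) (fun k => lev (k + 1)) (fun k => rs (k + 1)) (fun k => hrs (k + 1)) r hr' A hA
      -- the composite average of the tower below is `fine Lc M`-periodic
      have hB : ∀ (l : Fin (d + 1)) (y u : Fin (d + 1) → ℤ),
          compLinAvgAt r Lc (n + 1) A l (translate (fine Lc M) y u) = compLinAvgAt r Lc (n + 1) A l y :=
        compLinAvgAt_periodic Lc (fine Lc M) (n + 1) r A hA
      have htop : r (n + 1) = rs 1 := hr (n + 1) 0 rfl
      rw [compRows_succ, Finset.prod_range_succ' (fun i => stepScale d Lc (lev (i + 1))) (n + 1), compLinAvgAt_succ, htop]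
      calc ∑ q : ↥(pbox (towerTorus Lc M (n + 1 + 1))) × Fin (d + 1),
            (Qstep Lc M (lev 1) (rs 1) * compRows Lc (fine Lc M) (fun k => lev (k + 1)) (fun k => rs (k + 1)) (n + 1)) (x, κ) q
              * A q.2 (q.1 : Fin (d + 1) → ℤ)
          = ∑ p : ↥(pbox (fine Lc M)) × Fin (d + 1), Qstep Lc M (lev 1) (rs 1) (x, κ) p *
              ∑ q : ↥(pbox (towerTorus Lc M (n + 1 + 1))) × Fin (d + 1),
                compRows Lc (fine Lc M) (fun k => lev (k + 1)) (fun k => rs (k + 1)) (n + 1) p q * A q.2 (q.1 : Fin (d + 1) → ℤ) := by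
            simp only [Matrix.mul_apply, Finset.sum_mul, Finset.mul_sum, mul_assoc]
            exact Finset.sum_comm
        _ = ∑ p : ↥(pbox (fine Lc M)) × Fin (d + 1), Qstep Lc M (lev 1) (rs 1) (x, κ) p *
              ((∏ i ∈ Finset.range (n + 1), stepScale d Lc (lev (i + 1 + 1))) * compLinAvgAt r Lc (n + 1) A p.2 (p.1 : Fin (d + 1) → ℤ)) := by
            refine Finset.sum_congr rfl fun p _ => ?_
            obtain ⟨y, l⟩ := p
            exact congrArg (fun t : ℝ => Qstep Lc M (lev 1) (rs 1) (x, κ) (y, l) * t) (IH y l)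
        _ = (∏ i ∈ Finset.range (n + 1), stepScale d Lc (lev (i + 1 + 1))) *
              ∑ p : ↥(pbox (fine Lc M)) × Fin (d + 1), Qstep Lc M (lev 1) (rs 1) (x, κ) p * compLinAvgAt r Lc (n + 1) A p.2 (p.1 : Fin (d + 1) → ℤ) := by
            rw [Finset.mul_sum]
            refine Finset.sum_congr rfl fun p _ => ?_
            ring
        _ = (∏ i ∈ Finset.range (n + 1), stepScale d Lc (lev (i + 1 + 1))) *
              (stepScale d Lc (lev 1) * linAvgAt (toSite (rs 1)) (compLinAvgAt r Lc (n + 1) A) Lc κ (x : Fin (d + 1) → ℤ)) := by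
            rw [sum_Qstep_mul_periodic Lc M (lev 1) (hrs 1) (compLinAvgAt r Lc (n + 1) A) hB x κ]
        _ = _ := by ring

/-- [folklore] **THE SAME WITH ONE MORE STEP ON TOP, READ THROUGH A SLOT PRESENTATION** (the door's `𝔔₀ = Q₂₀ * Q₁₀` — system N of #21 ∕ #41d): for coarse
slots `a ↦ (pμ a, inr (mμ a))` of the box `M` at blocking `Lc` (`proj Lc (pμ a) = 0`, the door's `hcoarse′`), the level-`lev 0` step rows at root `rs 0` times the
tower's `compRows … (n+1)` act on a `T`-periodic form as `(∏_{i<n+2} stepScale d Lc (lev i)) · compLinAvgAt r Lc (n+2)`, read at the slot `(mμ a, pμ a ∕ Lc)`;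
root dictionary one storey up: `r i = rs j` whenever `i + j = n + 1`. -/
theorem sum_topStep_mul_compRows_mul_periodic (n : ℕ) (M : Fin (d + 1) → ℕ) [∀ μ, NeZero (M μ)] (lev : ℕ → ℕ)
    (rs : ℕ → (Fin (d + 1) → ℕ)) (hrs : ∀ k, rs k ∈ box (d + 1) Lc) (r : ℕ → (Fin (d + 1) → ℕ))
    (hr : ∀ i j : ℕ, i + j = n + 1 → r i = rs j) {κ' : Type*} [Fintype κ'] (pμ : κ' → ↥(pbox M)) (mμ : κ' → Fin (d + 1))
    (hpμ : ∀ a, Torus.proj Lc ((pμ a : ↥(pbox M)) : Fin (d + 1) → ℤ) = 0) (A : Form1 (d + 1) ℝ)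
    (hA : ∀ (l : Fin (d + 1)) (w t : Fin (d + 1) → ℤ), A l (translate (towerTorus Lc M (n + 1)) w t) = A l w) (a : κ') :
    ∑ q : ↥(pbox (towerTorus Lc M (n + 1))) × Fin (d + 1),
        ((perF M (bhKStepAt d (toSite (rs 0)) Lc (lev 0))).submatrix (fun a : κ' => ((pμ a, Sum.inr (mμ a)) : Idx M (Fib d)))
            (fun b : ↥(pbox M) × Fin (d + 1) => ((b.1, Sum.inl b.2) : Idx M (Fib d))) * compRows Lc M lev rs (n + 1)) a q
          * A q.2 (q.1 : Fin (d + 1) → ℤ)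
      = (∏ i ∈ Finset.range (n + 2), stepScale d Lc (lev i)) *
          compLinAvgAt r Lc (n + 2) A (mμ a) (quo Lc ((pμ a : ↥(pbox M)) : Fin (d + 1) → ℤ)) := by
  have hr' : ∀ i j : ℕ, i + j = n → r i = rs (j + 1) := fun i j hij => hr i (j + 1) (by omega)
  have hB : ∀ (l : Fin (d + 1)) (y u : Fin (d + 1) → ℤ), compLinAvgAt r Lc (n + 1) A l (translate M y u) = compLinAvgAt r Lc (n + 1) A l y :=
    compLinAvgAt_periodic Lc M (n + 1) r A hA
  have htop : r (n + 1) = rs 0 := hr (n + 1) 0 rfl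
  rw [Finset.prod_range_succ' (fun i => stepScale d Lc (lev i)) (n + 1), compLinAvgAt_succ, htop]
  calc ∑ q : ↥(pbox (towerTorus Lc M (n + 1))) × Fin (d + 1),
        ((perF M (bhKStepAt d (toSite (rs 0)) Lc (lev 0))).submatrix (fun a : κ' => ((pμ a, Sum.inr (mμ a)) : Idx M (Fib d)))
            (fun b : ↥(pbox M) × Fin (d + 1) => ((b.1, Sum.inl b.2) : Idx M (Fib d))) * compRows Lc M lev rs (n + 1)) a q
          * A q.2 (q.1 : Fin (d + 1) → ℤ)
      = ∑ p : ↥(pbox M) × Fin (d + 1), perF M (bhKStepAt d (toSite (rs 0)) Lc (lev 0)) (pμ a, Sum.inr (mμ a)) (p.1, Sum.inl p.2) *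
          ∑ q : ↥(pbox (towerTorus Lc M (n + 1))) × Fin (d + 1), compRows Lc M lev rs (n + 1) p q * A q.2 (q.1 : Fin (d + 1) → ℤ) := by
        simp only [Matrix.mul_apply, Matrix.submatrix_apply, Finset.sum_mul, Finset.mul_sum, mul_assoc]
        exact Finset.sum_comm
    _ = ∑ p : ↥(pbox M) × Fin (d + 1), perF M (bhKStepAt d (toSite (rs 0)) Lc (lev 0)) (pμ a, Sum.inr (mμ a)) (p.1, Sum.inl p.2) *
          ((∏ i ∈ Finset.range (n + 1), stepScale d Lc (lev (i + 1))) * compLinAvgAt r Lc (n + 1) A p.2 (p.1 : Fin (d + 1) → ℤ)) := by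
        refine Finset.sum_congr rfl fun p _ => ?_
        obtain ⟨y, l⟩ := p
        rw [sum_compRows_mul_periodic Lc n M lev rs hrs r hr' A hA y l]
    _ = (∏ i ∈ Finset.range (n + 1), stepScale d Lc (lev (i + 1))) * (stepScale d Lc (lev 0) *
          ∑ y : ↥(pbox M), ∑ l : Fin (d + 1), perZ M (bhKAt d (toSite (rs 0)) Lc) ((pμ a : ↥(pbox M)) : Fin (d + 1) → ℤ) (y : Fin (d + 1) → ℤ)
            (Sum.inr (mμ a)) (Sum.inl l) * compLinAvgAt r Lc (n + 1) A l (y : Fin (d + 1) → ℤ)) := by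
        rw [Fintype.sum_prod_type, Finset.mul_sum, Finset.mul_sum]
        refine Finset.sum_congr rfl fun y _ => ?_
        rw [Finset.mul_sum, Finset.mul_sum]
        refine Finset.sum_congr rfl fun l _ => ?_
        rw [perF_bhKStepAt_inr, perF_apply]
        ring
    _ = _ := by
        rw [sum_perZ_bhKAt_mul_periodic M (hrs 0) _ hB (hpμ a) (mμ a)]
        ring

end Composite

/-! ## §3 The entries of `compRows`: the composite average of the periodic bond indicator -/

section Entries

variable (Lc : ℕ) [NeZero Lc]

/-- [folklore] **THE ENTRIES OF `compRows` AS THE COMPOSITE AVERAGE OF A PERIODIC BOND INDICATOR**: for the tower of depth `n+1` below `M` with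
in-block roots `rs` (from the top) and bottom-indexed roots `r` (`r i = rs (j+1)` for `i + j = n`),
`compRows Lc M lev rs (n+1) (x, κ) (z, β) = (∏_{i<n+1} stepScale d Lc (lev (i+1))) · compLinAvgAt r Lc (n+1) ((l, w) ↦ δ_{(β,z)} (l, wrap T w)) κ x`,
`T = towerTorus Lc M (n+1)` (§2 at the periodic indicator). -/
theorem compRows_apply_eq_compLinAvgAt_wrap (n : ℕ) (M : Fin (d + 1) → ℕ) [∀ μ, NeZero (M μ)] (lev : ℕ → ℕ)
    (rs : ℕ → (Fin (d + 1) → ℕ)) (hrs : ∀ k, rs k ∈ box (d + 1) Lc) (r : ℕ → (Fin (d + 1) → ℕ))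
    (hr : ∀ i j : ℕ, i + j = n → r i = rs (j + 1)) (x : ↥(pbox M)) (κ : Fin (d + 1))
    (z : ↥(pbox (towerTorus Lc M (n + 1)))) (β : Fin (d + 1)) :
    compRows Lc M lev rs (n + 1) (x, κ) (z, β)
      = (∏ i ∈ Finset.range (n + 1), stepScale d Lc (lev (i + 1))) *
          compLinAvgAt r Lc (n + 1) (fun l w => delta1 β (z : Fin (d + 1) → ℤ) l (wrap (towerTorus Lc M (n + 1)) w)) κ (x : Fin (d + 1) → ℤ) := by
  classical
  have hA : ∀ (l : Fin (d + 1)) (w t : Fin (d + 1) → ℤ),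
      (fun l w => delta1 β (z : Fin (d + 1) → ℤ) l (wrap (towerTorus Lc M (n + 1)) w)) l (translate (towerTorus Lc M (n + 1)) w t)
        = (fun l w => delta1 β (z : Fin (d + 1) → ℤ) l (wrap (towerTorus Lc M (n + 1)) w)) l w := fun l w t => by
    show delta1 β _ l (wrap _ (translate _ w t)) = delta1 β _ l (wrap _ w)
    rw [B6Lemma24Torus.wrap_congr (x' := w)]
    intro i
    rw [translate_apply]
    exact ⟨t i, by ring⟩
  rw [← sum_compRows_mul_periodic Lc n M lev rs hrs r hr _ hA x κ]
  -- on the box the periodic indicator is the Kronecker delta at `(z, β)`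
  have hval : ∀ q : ↥(pbox (towerTorus Lc M (n + 1))) × Fin (d + 1),
      (fun l w => delta1 β (z : Fin (d + 1) → ℤ) l (wrap (towerTorus Lc M (n + 1)) w)) q.2 (q.1 : Fin (d + 1) → ℤ)
        = if q = (z, β) then 1 else 0 := fun q => by
    show delta1 β _ q.2 (wrap _ _) = _
    rw [wrap_eq_self q.1.2, delta1_apply]
    obtain ⟨w, l⟩ := q
    by_cases h : (w, l) = (z, β)
    · rw [if_pos h, if_pos]
      obtain ⟨h1, h2⟩ := Prod.mk.inj h
      exact ⟨h2, by rw [h1]⟩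
    · rw [if_neg h, if_neg]
      rintro ⟨h2, h1⟩
      exact h (Prod.ext (Subtype.ext h1) h2)
  simp only [hval, mul_ite, mul_one, mul_zero, Finset.sum_ite_eq', Finset.mem_univ, if_true]

end Entries


end Summit.QuantumFields.BalabanUV.Beta.FP.TorusCompositeRowsPeriodic

end
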